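import Summits.BirchSwinnertonDyer.BirchSwinnertonDyer.Theorems.ManinLocalTwoThreeSymbolDiamondBottom
import Summits.BirchSwinnertonDyer.BirchSwinnertonDyer.Theorems.ManinLocalTwoThreeShiftClosureDelta
import HarnessLib

/-!
# An `A_tⁿ`-invariant `Γ₀(tᵏL')`-cusp symbol has a DIAMOND boundary map — LEMMA G (p1) at symbol level composed with
# the Vaserstein bottom (p3): the core of E-es-35 `ShiftInvariantIsDiamond` below the lift

Summit `BirchSwinnertonDyer`, route `ManinLocalTwoThree` (cell bsd-f2-manin), deciding crux C2 `ManinOddAtFour`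
(stmt-BirchSwinnertonDyer-22967) and crux C3 `ManinPrimeToThreeAtNine` (stmt-BirchSwinnertonDyer-22968); registered stubs
`stub_relativeIharaBarTwo` / `stub_relativeIharaBar331` = the leaf E-es-25 `RelativeIharaShiftVanishingBar p t n` ⟸
E-es-35 alone (`relativeIharaShiftVanishingBar_of_shiftInvariantIsDiamond`, p3).  MEMO-es §23 proves E-es-35 by lifting the
shift-invariant class `u` to a `Γ₀(L)`-invariant cusp symbol `Φ` which is ALSO invariant under `A = diag(tⁿ, 1)`; this file
kernel-checks everything BELOW that point:

* `symbolStabilizer Φ j` is not a definition but the inline subgroup `{g : Φ(j g a, j g b) = Φ(a, b)}` of `SL₂(ℤ[1/t])`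
  (closure under `1`, `*`, `⁻¹` = p2's `cuspSymbol_invariant_one/mul/inv`), for the embedding `j = toGL ∘ SL₂(f)`,
  `f : ℤ[1/t] →+* ℚ`;
* `toGL_map_shift_eq` — the embedding turns p1's ENTRY-WISE shift `(α, β; γ, δ) ↦ (α, tⁿβ; t⁻ⁿγ, δ)` into conjugation by
  `A` in `GL₂(ℚ)`: `j(g') · A = A · j(g)` (and the inverse shift: `A · j(g') = j(g) · A`);
* **`delta_le_symbolStabilizer`** — LEMMA G at symbol level: if `Φ` is invariant under `Γ₀(tᵏ L')` (through `mapGL ℚ`)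
  and under `A`, then `Φ` is invariant under `j(Δ_t(L'))` (p1's `delta_le_of_gamma0Image_le_of_shiftStable`, E-es-31);
* **`exists_diamondFun_of_invariant_of_shift_invariant`** — THE CORE: for `t` prime, `n ≥ 1`, `t ∤ L'`, `L' ≥ 1`, an
  additive cusp symbol invariant under `Γ₀(tᵏ L')` and under `A = diag(tⁿ,1)` has boundary map
  `(γ ↦ Φ(∞, γ∞)) = diamondFun (tᵏ L') L' K η` with `η` additive on the units of `ℤ/L'`
  (p3's `exists_diamondFun_of_cuspSymbol_invariant_map`, E-es-34 via Vaserstein).  With `eq_zero_of_coe_eq_diamondFun`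
  (p3) the class `u = δΦ` then vanishes unless `λ̄` is Eisenstein.

So E-es-35 is reduced to: (lift) a parabolic shift-invariant generalised eigenclass is `δΦ` for a `Γ₀(L)`-invariant `Φ`
(p2's E-es-29a (i)) which can be made `A`-invariant (the discrepancy `Φ∘A − Φ` is boundary, p3's
`exists_boundary_of_shiftInvariant`; it is killed by a Hecke polynomial once E-es-30 holds at level `L tⁿ`), and
(parabolicity) of non-Eisenstein generalised eigenclasses.  Nothing about BSD or Manin's conjecture is proved here.

References: HOME/MEMO-es.md §23.1–23.2 (cell bsd-f2-manin); J.-P. Serre, Ann. of Math. 92 (1970) §2.6 and L. N. Vaserstein,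
Mat. Sb. 89 (1972) (the S-arithmetic inputs, both tree theorems).
-/

set_option autoImplicit false
set_option linter.dupNamespace false

open scoped MatrixGroups

open CongruenceSubgroup Matrix.SpecialLinearGroup
  Summit.BirchSwinnertonDyer.BirchSwinnertonDyer.Theorems.ConjSpanGenAllLevels
  Summit.BirchSwinnertonDyer.Rank1Residual.ManinAdditive

namespace Summit.BirchSwinnertonDyer.BirchSwinnertonDyer.Theorems.ManinLocalTwoThree

noncomputable section

/-! ### §1  The stabilizer of a cusp map in `SL₂(ℤ[1/t])` through `j = toGL ∘ SL₂(f)` -/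

section Stabilizer

variable {t : ℕ} (f : Away t →+* ℚ) {K : Type*} (Φ : OnePoint ℚ → OnePoint ℚ → K)

/-- The elements of `SL₂(ℤ[1/t])` whose image in `GL₂(ℚ)` leaves the cusp map `Φ` invariant form a subgroup (stated
through `Subgroup.closure`: the invariance set is closed, so it equals the subgroup it generates). [folklore] -/
theorem mem_closure_symbolStabilizer_iff (g : SL(2, Away t)) :
    g ∈ Subgroup.closure {g : SL(2, Away t) |
        ∀ a b, Φ ((toGL : SL(2, ℚ) →* GL (Fin 2) ℚ).comp (map f) g • a)
          ((toGL : SL(2, ℚ) →* GL (Fin 2) ℚ).comp (map f) g • b) = Φ a b} ↔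
      ∀ a b, Φ ((toGL : SL(2, ℚ) →* GL (Fin 2) ℚ).comp (map f) g • a)
        ((toGL : SL(2, ℚ) →* GL (Fin 2) ℚ).comp (map f) g • b) = Φ a b := by
  constructor
  · intro hg
    induction hg using Subgroup.closure_induction with
    | mem x hx => exact hx
    | one => intro a b; rw [map_one]; exact cuspSymbol_invariant_one Φ a b
    | mul x y _ _ hx hy => intro a b; rw [map_mul]; exact cuspSymbol_invariant_mul Φ hx hy a b
    | inv x _ hx => intro a b; rw [map_inv]; exact cuspSymbol_invariant_inv Φ hx a b
  · exact fun hg => Subgroup.subset_closure hg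

end Stabilizer

/-! ### §2  The embedding turns the entry-wise shift into conjugation by `A = diag(tⁿ, 1)` -/

section Shift

variable {t n : ℕ} (f : Away t →+* ℚ) (A : GL (Fin 2) ℚ) (hA : (A : Matrix (Fin 2) (Fin 2) ℚ) = !![((t : ℚ) ^ n), 0; 0, 1])

/-- `f(tᵐ) = tᵐ` (plumbing). [folklore] -/
theorem map_natCast_pow_away (m : ℕ) : f ((t : Away t) ^ m) = (t : ℚ) ^ m := by
  rw [map_pow, map_natCast]

include hA

/-- **Shift ⟹ conjugation**: if `g'` is the entry-wise shift `(α, tⁿβ; t⁻ⁿγ, δ)` of `g` (p1's hypothesis shape `hS`), then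
`j(g') · A = A · j(g)` in `GL₂(ℚ)`. [folklore] -/
theorem toGL_map_shift_eq {g g' : SL(2, Away t)} (h00 : g' 0 0 = g 0 0) (h01 : g' 0 1 = (t : Away t) ^ n * g 0 1)
    (h10 : (t : Away t) ^ n * g' 1 0 = g 1 0) (h11 : g' 1 1 = g 1 1) :
    (toGL : SL(2, ℚ) →* GL (Fin 2) ℚ).comp (map f) g' * A = A * (toGL : SL(2, ℚ) →* GL (Fin 2) ℚ).comp (map f) g := by
  apply Matrix.GeneralLinearGroup.ext
  intro i k
  rw [Units.val_mul, Units.val_mul, hA]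
  have e00 : f (g' 0 0) = f (g 0 0) := by rw [h00]
  have e01 : f (g' 0 1) = (t : ℚ) ^ n * f (g 0 1) := by rw [h01, map_mul, map_natCast_pow_away f]
  have e10 : (t : ℚ) ^ n * f (g' 1 0) = f (g 1 0) := by rw [← h10, map_mul, map_natCast_pow_away f]
  have e11 : f (g' 1 1) = f (g 1 1) := by rw [h11]
  fin_cases i <;> fin_cases k <;>
    simp [Matrix.mul_apply, Fin.sum_univ_two, e00, e01, ← e10, e11, mul_comm]

/-- **Inverse shift ⟹ conjugation**: if `g'` is the entry-wise shift `(α, t⁻ⁿβ; tⁿγ, δ)` of `g` (p1's `hS'`), then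
`A · j(g') = j(g) · A`. [folklore] -/
theorem toGL_map_shiftInv_eq {g g' : SL(2, Away t)} (h00 : g' 0 0 = g 0 0) (h01 : (t : Away t) ^ n * g' 0 1 = g 0 1)
    (h10 : g' 1 0 = (t : Away t) ^ n * g 1 0) (h11 : g' 1 1 = g 1 1) :
    A * (toGL : SL(2, ℚ) →* GL (Fin 2) ℚ).comp (map f) g' = (toGL : SL(2, ℚ) →* GL (Fin 2) ℚ).comp (map f) g * A :=
  (toGL_map_shift_eq f A hA h00.symm h01.symm h10.symm h11.symm).symm

end Shift

/-! ### §3  LEMMA G at symbol level and the diamond conclusion -/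

section Main

variable {t n k L' : ℕ} [NeZero t] (f : Away t →+* ℚ) {K : Type*}
  (A : GL (Fin 2) ℚ) (hA : (A : Matrix (Fin 2) (Fin 2) ℚ) = !![((t : ℚ) ^ n), 0; 0, 1])

include hA

/-- **LEMMA G (E-es-31) at symbol level.**  For `t` prime, `n ≥ 1`, `t ∤ L'`: a cusp map `Φ` invariant under
`Γ₀(tᵏ L')` (through `mapGL ℚ`) and under `A = diag(tⁿ, 1)` is invariant under `j(g)` for every `g ∈ Δ_t(L')`,
`j = toGL ∘ SL₂(f)`.  Proof: the stabilizer `H` of `Φ` in `SL₂(ℤ[1/t])` contains `ι Γ₀(tᵏL')` (`j ∘ ι = mapGL`) and is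
stable under both entry-wise shifts (they are conjugation by `A^{±1}` after `j`), so p1's
`delta_le_of_gamma0Image_le_of_shiftStable` gives `Δ_t(L') ≤ H`.  Additivity of `Φ` is not needed. [folklore] -/
theorem delta_le_symbolStabilizer (htp : t.Prime) (hn : 1 ≤ n) (hL' : ¬ t ∣ L') (Φ : OnePoint ℚ → OnePoint ℚ → K)
    (hinv : ∀ γ : Gamma0 (t ^ k * L'), ∀ a b, Φ (mapGL ℚ (γ : SL(2, ℤ)) • a) (mapGL ℚ (γ : SL(2, ℤ)) • b) = Φ a b)
    (hAinv : ∀ a b, Φ (A • a) (A • b) = Φ a b) :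
    ∀ g ∈ Delta t L', ∀ a b,
      Φ ((toGL : SL(2, ℚ) →* GL (Fin 2) ℚ).comp (map f) g • a) ((toGL : SL(2, ℚ) →* GL (Fin 2) ℚ).comp (map f) g • b) =
        Φ a b := by
  set H : Subgroup SL(2, Away t) := Subgroup.closure {g : SL(2, Away t) |
      ∀ a b, Φ ((toGL : SL(2, ℚ) →* GL (Fin 2) ℚ).comp (map f) g • a)
        ((toGL : SL(2, ℚ) →* GL (Fin 2) ℚ).comp (map f) g • b) = Φ a b} with hH
  have hAinv' : ∀ a b, Φ (A⁻¹ • a) (A⁻¹ • b) = Φ a b := cuspSymbol_invariant_inv Φ hAinv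
  -- `ι Γ₀(tᵏ L') ≤ H`
  have hΓ : gamma0Image t (t ^ k * L') ≤ H := by
    rintro _ ⟨γ, hγ, rfl⟩
    rw [hH, mem_closure_symbolStabilizer_iff]
    intro a b
    rw [toGL_map_iota_eq_mapGL]
    exact hinv ⟨γ, hγ⟩ a b
  -- stability under the shift `g ↦ A g A⁻¹`
  have hS : ∀ g ∈ H, ∀ g' : SL(2, Away t), g' 0 0 = g 0 0 → g' 0 1 = (t : Away t) ^ n * g 0 1 →
      (t : Away t) ^ n * g' 1 0 = g 1 0 → g' 1 1 = g 1 1 → g' ∈ H := by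
    intro g hg g' h00 h01 h10 h11
    rw [hH, mem_closure_symbolStabilizer_iff] at hg ⊢
    have e : (toGL : SL(2, ℚ) →* GL (Fin 2) ℚ).comp (map f) g' =
        A * (toGL : SL(2, ℚ) →* GL (Fin 2) ℚ).comp (map f) g * A⁻¹ := by
      rw [← toGL_map_shift_eq f A hA h00 h01 h10 h11, mul_inv_cancel_right]
    intro a b
    rw [e]
    exact cuspSymbol_invariant_mul Φ (cuspSymbol_invariant_mul Φ hAinv hg) hAinv' a b
  -- stability under the inverse shift `g ↦ A⁻¹ g A`
  have hS' : ∀ g ∈ H, ∀ g' : SL(2, Away t), g' 0 0 = g 0 0 → (t : Away t) ^ n * g' 0 1 = g 0 1 →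
      g' 1 0 = (t : Away t) ^ n * g 1 0 → g' 1 1 = g 1 1 → g' ∈ H := by
    intro g hg g' h00 h01 h10 h11
    rw [hH, mem_closure_symbolStabilizer_iff] at hg ⊢
    have e : (toGL : SL(2, ℚ) →* GL (Fin 2) ℚ).comp (map f) g' =
        A⁻¹ * ((toGL : SL(2, ℚ) →* GL (Fin 2) ℚ).comp (map f) g * A) := by
      rw [← toGL_map_shiftInv_eq f A hA h00 h01 h10 h11, inv_mul_cancel_left]
    intro a b
    rw [e]
    exact cuspSymbol_invariant_mul Φ hAinv' (cuspSymbol_invariant_mul Φ hg hAinv) a b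
  intro g hg
  have hmem : g ∈ H := delta_le_of_gamma0Image_le_of_shiftStable H htp hn hL' k hΓ hS hS' hg
  rw [hH, mem_closure_symbolStabilizer_iff] at hmem
  exact hmem

variable [CommRing K]

/-- **THE CORE OF E-es-35 BELOW THE LIFT.**  Let `t` be prime, `n ≥ 1`, `t ∤ L'`, `L' ≥ 1`, `2 ≤ t` automatic.  An ADDITIVE
cusp symbol `Φ` on `P¹(ℚ)` with values in `K`, invariant under `Γ₀(tᵏ L')` and under `A = diag(tⁿ, 1)`, has a DIAMOND
boundary map: `(γ ↦ Φ(∞, γ∞)) = diamondFun (tᵏ L') L' K η` on `Γ₀(tᵏ L')`, with `η : ℤ/L' → K` additive on units.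
(LEMMA G at symbol level + E-es-34 via Vaserstein, `exists_diamondFun_of_cuspSymbol_invariant_map`; any ring map
`f : ℤ[1/t] →+* ℚ` serves as the embedding.) [folklore] -/
theorem exists_diamondFun_of_invariant_of_shift_invariant (htp : t.Prime) (hn : 1 ≤ n) (hL' : ¬ t ∣ L') [NeZero L']
    (Φ : OnePoint ℚ → OnePoint ℚ → K) (hsym : ∀ a b c, Φ a b + Φ b c = Φ a c)
    (hinv : ∀ γ : Gamma0 (t ^ k * L'), ∀ a b, Φ (mapGL ℚ (γ : SL(2, ℤ)) • a) (mapGL ℚ (γ : SL(2, ℤ)) • b) = Φ a b)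
    (hAinv : ∀ a b, Φ (A • a) (A • b) = Φ a b) :
    ∃ η : ZMod L' → K, (∀ a b : ZMod L', IsUnit a → IsUnit b → η (a * b) = η a + η b) ∧
      (fun (γ : Gamma0 (t ^ k * L')) (_ : Fin 1) => Φ OnePoint.infty (mapGL ℚ (γ : SL(2, ℤ)) • OnePoint.infty)) =
        diamondFun (t ^ k * L') L' K η := by
  -- any ring map `ℤ[1/t] → ℚ` serves as the embedding; take the canonical one
  let f₀ : Away t →+* ℚ := IsLocalization.Away.lift (S := Away t) (t : ℤ) (g := Int.castRingHom ℚ)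
    (by rw [eq_intCast, Int.cast_natCast]; exact isUnit_iff_ne_zero.2 (Nat.cast_ne_zero.2 htp.ne_zero))
  exact exists_diamondFun_of_cuspSymbol_invariant_map f₀ htp.two_le (dvd_mul_left L' (t ^ k)) Φ hsym
    (delta_le_symbolStabilizer f₀ A hA htp hn hL' Φ hinv hAinv)

end Main

end

end Summit.BirchSwinnertonDyer.BirchSwinnertonDyer.Theorems.ManinLocalTwoThree
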